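import Summits.QuantumFields.BalabanUV.T4Continuum.Support.NE7CurvedLiftBookkeeping
import Summits.QuantumFields.BalabanUV.T4Continuum.Support.NE7TanCriticalGauge
import Summits.QuantumFields.BalabanUV.T4Continuum.Support.NE7ConvOneStepWeightedUnique
import Summits.QuantumFields.BalabanUV.T4Continuum.Spine.NE3.CurvedLandauRep
import HarnessLib

/-!
# NE7ApeCurvedRepDocking — (APE) WITH A DATUM, REP DISCHARGED: a TANGENT-CRITICAL configuration `U` of the class, (−1)∕(−2)-close to a background `W` of the
# multi-level small-field class, has `SmallField U (x + K_G(τ + ρ + κ) + c_N + 28α₀²)`, `α₀ = 2r⋆` — row NE3's brick E′ `CurvedLandauRep.exists_landauRep_W` supplies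
# the B8 (1.38)-Landau representative `U^{u} = We^{Z}`, F55 runs the bootstrap on it, gauge covariance carries criticality in and the radius out

Cell `pub-balaban`, rung (B)+1 sub-cell t4, lineage `b2b-balaban-t4-ne7-p1` (CRUX PROVER NE7 #1 = OWNER of row NE7), generation 75.  File F57, over F55
`NE7CurvedLiftBookkeeping.smallField_vary_of_curvedLetters` (this generation, p410174), row NE3's brick E′ `Spine/NE3/CurvedLandauRep.exists_landauRep_W`
(OWNER t4-ne3-p1 g27; filed by courier pub-ymgap-dag-n16-b, 2026-08-25), F39 `NE7TanCriticalGauge.tanCritical_gaugeAct` and `NE7ConvOneStepWeightedUnique.smallField_of_gaugeAct_eq`.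

WHY.  F55 is the (APE) bootstrap at a curved background for a representative `We^{A}`; the gauge `A` is SUPPLIED by [Balaban1985RegularSpaces] Thm 2 ∕ Prop 5 TYPE
representation — which, for backgrounds of the multi-level class and (−1)∕(−2) relative data, is now a TREE THEOREM (brick E′: `∃ u, Z` unitary∕skew periodic,
`U^{u} = We^{Z}`, `Z` EXACTLY (1.38)-Landau relative to `W`, `‖Z‖ ≤ 2r⋆`).  THIS FILE docks E′ into F55: the statement is about the tangent-critical `U` ITSELF
(no representative displayed), and the REP letter is GONE.  The remaining analytic letters are asked FOR EVERY Landau representative with the sup member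
(`∀ Z` skew periodic, `IsLandauB8 W Z`, `‖Z‖ ≤ α₀`: normal lift `A_N` with (hNexact)(hN7)(hNorth) and `Z − A_N ∈ S`, tangent transport (hTT)) — the honest
contract, since E′ chooses `Z`; the slice solver (hG), the second-order remainder (hEXP, DISCHARGED in weak form by F56 `NE7ExpansionRemainderCurvedWeak`) and the
background tension (hWten) do not depend on the representative.

WHAT ([folklore]; 0 def, 0 sorry).  **`smallField_of_tanCritical_curvedLetters_W`** (`d ≥ 1`, `L ≥ 2`, `N ≥ 1`, level `j+1`, `P = N·L^{j+1}`, `M = L^{j+1}`,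
`F = frameC d L + d`, `c_R = 1 + 2·card n·(64d²N)^d + 27(card n)³512^dN^d`).  Background `W`: unitary `P`-periodic, `LevelSmall d L j x`, `SmallField W x`, covariant
plaquette gradients `≤ x₁`, the four level-free lines of E′.  Field `U`: unitary `P`-periodic, of the class at radius `x_U` (`LevelSmall d L j x_U`, `SmallField U x_U`),
TANGENT-CRITICAL (`dirIter L (j+1) U Y = 0 ⟹ dAction U Y (perWin d P) = 0` on skew periodic `Y`), with relative data `‖W⁻¹U − 1‖ ≤ r₀`, `‖covDiv_W log W⁻¹U‖_∞ ≤ b₀`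
under E′'s four closed lines (hreg₁–₃, hline).  Letters (hNlift ∀Z, hG, hEXP, hWten, hTT ∀Z) as in F55 at `α₀ := 2r⋆`, `r⋆ = r₀ + (5∕2)·36dF·M·c_R·b₀`.
THEN `SmallField U (x + (K_G(τ + ρ + κ) + c_N + 28α₀²))`.

HONEST FRAMING (page 1): composition over the displayed letters (normal lift, slice solver, tangent transport at a curved `W`: NOT proved; hEXP: weak form in the
tree, strong form open; background tension: a property of the chosen `W`); REP at curved data IS discharged (row NE3's E′, global torus version, two regularity
radii of `W` displayed); nothing of Bałaban's asserted ([Balaban1985Variational] Sect. F TYPE); (APE) on curved data NOT proved; NOT ONE-STEP, NOT NE7; spine 0∕9;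
finite T⁴ rung (B)+1 — NOT infinite volume, NOT mass gap, NOT `BetaPertH`, NOT Clay.  Continuum YM on T⁴ ⇐ BetaPertH ∧ nine spine estimates (0/9 proved); BetaPertH ⇐
(D1) ∧ (D4) ∧ CAP+tail; G-an2-4 gates asym, D1 and NE2/3/4.
-/

set_option autoImplicit false

open scoped BigOperators Matrix Matrix.Norms.L2Operator
open NormedSpace Finset Set

namespace Summit.QuantumFields.BalabanUV.T4Continuum.NE7ApeCurvedRepDocking

open Literature.MathematicalPhysics.QuantumFieldTheory.Balaban1983to89
open B7Prop1Explicit B7Prop2Explicit MatrixLog UnitaryModel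
open T4AveragingDeficitWall (Ad IsUnitaryCfg IsSkewDir SmallField vary curlAt dirL1)
open T4AveragingDeficitWallBoundary (IsPeriodicCfg periodBox)
open AveragingDeficitPeriodicCounting (IsPeriodicDir)
open AveragingDeficitMultiLevelPrep (LevelSmall)
open MinimalActionLevels (perWin)
open NE3HessForm (hess dAction)
open NE3TangentCovariantTower (dirIter)
open NE3EnergyShapes (IsUnitarySite IsPeriodicSite)
open NE3CovariantWeitzenbock (covDiv)
open NE3RightInverseSupLetters (frameC)
open NE3.PairLandauB8 (IsLandauB8)
open NE3.CurvedLandauRep (exists_landauRep_W)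
open NE7TanCriticalGauge (tanCritical_gaugeAct)
open NE7ConvOneStepWeightedUnique (smallField_of_gaugeAct_eq)
open NE7CurvedLiftBookkeeping (smallField_vary_of_curvedLetters)

noncomputable section

variable {d : ℕ} {n : Type*} [Fintype n] [DecidableEq n]

/-- **(APE) WITH A DATUM, REP DISCHARGED** (statement in the module docstring): a tangent-critical `U` of the class, (−1)∕(−2)-close to a background `W` of the
multi-level class, has `SmallField U (x + (K_G(τ + ρ + κ) + c_N + 28α₀²))` with `α₀ = 2r⋆`, given F55's analytic letters at `W` for every Landau representative
with the sup member.  E′ BY NAME + F55 + gauge covariance. [folklore] -/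
theorem smallField_of_tanCritical_curvedLetters_W [Nonempty n] (hd : 1 ≤ d) {L N : ℕ} [NeZero N] (hL : 2 ≤ L) (j : ℕ)
    -- the background
    {W : Site d → Fin d → (Matrix n n ℂ)ˣ} {x x₁ : ℝ} (hWu : IsUnitaryCfg W) (hWP : IsPeriodicCfg W ((N * L ^ (j + 1) : ℕ) : ℤ))
    (hx : 0 ≤ x) (hs : LevelSmall d L j x) (hWx : SmallField W x) (hx10 : 0 ≤ x₁)
    (hgrad : ∀ (p : Site d) (μ κ : Fin d), κ ≠ μ →
      ‖Ad (W p μ) ((hol W (p + e μ) (plaqWord κ μ) : (Matrix n n ℂ)ˣ) : Matrix n n ℂ) - ((hol W p (plaqWord κ μ) : (Matrix n n ℂ)ˣ) : Matrix n n ℂ)‖ ≤ x₁)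
    (hbx : 23040 * (d : ℝ) ^ 4 * (frameC d L + d) ^ 2 * ((L : ℝ) ^ (j + 1)) ^ 2 * x ≤ 1)
    (hcx : 11520 * (d : ℝ) ^ 4 * (frameC d L + d) ^ 3 * ((L : ℝ) ^ (j + 1)) ^ 3 * x₁ ≤ 1)
    (hbx' : 256 * (d : ℝ) ^ 2 * ((L : ℝ) ^ (j + 1)) ^ 2 * x ≤ 1) (hcx' : 16 * (d : ℝ) * ((L : ℝ) ^ (j + 1)) ^ 3 * x₁ ≤ 1)
    -- the field: of the class, tangent-critical, (−1)/(−2)-close to `W`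
    {U : Site d → Fin d → (Matrix n n ℂ)ˣ} (hUu : IsUnitaryCfg U) (hUP : IsPeriodicCfg U ((N * L ^ (j + 1) : ℕ) : ℤ))
    {xU : ℝ} (hxU : 0 ≤ xU) (hsU : LevelSmall d L j xU) (hUxU : SmallField U xU)
    (hcritU : ∀ Y : Site d → Fin d → Matrix n n ℂ, IsSkewDir Y → IsPeriodicDir Y ((N * L ^ (j + 1) : ℕ) : ℤ) →
      dirIter L (j + 1) U Y = 0 → dAction U Y (perWin d (N * L ^ (j + 1))) = 0)
    {r₀ b₀ : ℝ} (hr₀ : ∀ (y : Site d) (μ : Fin d), ‖(((W y μ)⁻¹ * U y μ : (Matrix n n ℂ)ˣ) : (Matrix n n ℂ)) - 1‖ ≤ r₀)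
    (hb₀ : ∀ x : Site d, ‖covDiv W (fun y μ => mlog (((W y μ)⁻¹ * U y μ : (Matrix n n ℂ)ˣ) : (Matrix n n ℂ))) x‖ ≤ b₀)
    (hreg₁ : (36 * (d : ℝ) * (frameC d L + d) ^ 2) * ((L : ℝ) ^ (j + 1)) ^ 2
      * ((1 + 2 * (Fintype.card n : ℝ) * (64 * (d : ℝ) ^ 2 * N) ^ d + 27 * (Fintype.card n : ℝ) ^ 3 * (512 : ℝ) ^ d * (N : ℝ) ^ d) * b₀) ≤ 1 / 10)
    (hreg₂ : (36 * (d : ℝ) * (frameC d L + d)) * (L : ℝ) ^ (j + 1)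
      * ((1 + 2 * (Fintype.card n : ℝ) * (64 * (d : ℝ) ^ 2 * N) ^ d + 27 * (Fintype.card n : ℝ) ^ 3 * (512 : ℝ) ^ d * (N : ℝ) ^ d) * b₀) ≤ 1 / 25)
    (hreg₃ : r₀ + 5 / 2 * ((36 * (d : ℝ) * (frameC d L + d)) * (L : ℝ) ^ (j + 1)
      * ((1 + 2 * (Fintype.card n : ℝ) * (64 * (d : ℝ) ^ 2 * N) ^ d + 27 * (Fintype.card n : ℝ) ^ 3 * (512 : ℝ) ^ d * (N : ℝ) ^ d) * b₀)) ≤ 1 / 20)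
    (hline : (1 + 2 * (Fintype.card n : ℝ) * (64 * (d : ℝ) ^ 2 * N) ^ d + 27 * (Fintype.card n : ℝ) ^ 3 * (512 : ℝ) ^ d * (N : ℝ) ^ d)
      * (4 * ((36 * (d : ℝ) * (frameC d L + d) ^ 2) * ((L : ℝ) ^ (j + 1)) ^ 2)
          * (b₀ + 4 * ((1 + 2 * (Fintype.card n : ℝ) * (64 * (d : ℝ) ^ 2 * N) ^ d + 27 * (Fintype.card n : ℝ) ^ 3 * (512 : ℝ) ^ d * (N : ℝ) ^ d) * b₀))
        + 25 * d * (r₀ + 5 / 2 * ((36 * (d : ℝ) * (frameC d L + d)) * (L : ℝ) ^ (j + 1)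
            * ((1 + 2 * (Fintype.card n : ℝ) * (64 * (d : ℝ) ^ 2 * N) ^ d + 27 * (Fintype.card n : ℝ) ^ 3 * (512 : ℝ) ^ d * (N : ℝ) ^ d) * b₀)))
            * ((36 * (d : ℝ) * (frameC d L + d)) * (L : ℝ) ^ (j + 1))
        + 14 * d * ((36 * (d : ℝ) * (frameC d L + d)) * (L : ℝ) ^ (j + 1)) ^ 2
            * ((1 + 2 * (Fintype.card n : ℝ) * (64 * (d : ℝ) ^ 2 * N) ^ d + 27 * (Fintype.card n : ℝ) ^ 3 * (512 : ℝ) ^ d * (N : ℝ) ^ d) * b₀)) ≤ 1 / 2)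
    -- the sup radius of the representative
    {α₀ : ℝ} (hα₀ : 2 * (r₀ + 5 / 2 * ((36 * (d : ℝ) * (frameC d L + d)) * (L : ℝ) ^ (j + 1)
        * ((1 + 2 * (Fintype.card n : ℝ) * (64 * (d : ℝ) ^ 2 * N) ^ d + 27 * (Fintype.card n : ℝ) ^ 3 * (512 : ℝ) ^ d * (N : ℝ) ^ d) * b₀))) ≤ α₀)
    -- the analytic letters at `W`, for EVERY Landau representative with the sup member
    (S : Set (Site d → Fin d → Matrix n n ℂ)) {cN KG ρ κ τ : ℝ} (hρ : 0 ≤ ρ) (hκ : 0 ≤ κ) (hτ : 0 ≤ τ)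
    (hNlift : ∀ Z : Site d → Fin d → Matrix n n ℂ, IsSkewDir Z → IsPeriodicDir Z ((N * L ^ (j + 1) : ℕ) : ℤ) →
      IsLandauB8 (d := d) L N (j + 1) W Z → (∀ y μ, ‖Z y μ‖ ≤ α₀) →
      ∃ AN : Site d → Fin d → Matrix n n ℂ, IsPeriodicDir AN ((N * L ^ (j + 1) : ℕ) : ℤ) ∧
        dirIter L (j + 1) W AN = dirIter L (j + 1) W Z ∧
        (∀ z μ ν, μ ≠ ν → ‖curlAt W AN z μ ν‖ ≤ cN) ∧
        (∀ Y : Site d → Fin d → Matrix n n ℂ, IsSkewDir Y → IsPeriodicDir Y ((N * L ^ (j + 1) : ℕ) : ℤ) → dirIter L (j + 1) W Y = 0 →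
          hess W AN Y (perWin d (N * L ^ (j + 1))) = 0) ∧
        (fun y μ => Z y μ - AN y μ) ∈ S)
    (hG : ∀ X ∈ S, IsPeriodicDir X ((N * L ^ (j + 1) : ℕ) : ℤ) → dirIter L (j + 1) W X = 0 → ∀ g : ℝ, 0 ≤ g →
      (∀ Y : Site d → Fin d → Matrix n n ℂ, IsSkewDir Y → IsPeriodicDir Y ((N * L ^ (j + 1) : ℕ) : ℤ) → dirIter L (j + 1) W Y = 0 →
        |hess W X Y (perWin d (N * L ^ (j + 1)))| ≤ g * dirL1 Y (periodBox (d := d) (N * L ^ (j + 1)))) →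
      ∀ z μ ν, μ ≠ ν → ‖curlAt W X z μ ν‖ ≤ KG * g)
    (hEXP : ∀ Z : Site d → Fin d → Matrix n n ℂ, IsSkewDir Z → IsPeriodicDir Z ((N * L ^ (j + 1) : ℕ) : ℤ) → (∀ y μ, ‖Z y μ‖ ≤ α₀) →
      ∀ Y : Site d → Fin d → Matrix n n ℂ, IsSkewDir Y → IsPeriodicDir Y ((N * L ^ (j + 1) : ℕ) : ℤ) →
      |dAction (vary W Z 1) Y (perWin d (N * L ^ (j + 1))) - dAction W Y (perWin d (N * L ^ (j + 1))) - hess W Z Y (perWin d (N * L ^ (j + 1)))|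
        ≤ ρ * dirL1 Y (periodBox (d := d) (N * L ^ (j + 1))))
    (hWten : ∀ Y : Site d → Fin d → Matrix n n ℂ, IsSkewDir Y → IsPeriodicDir Y ((N * L ^ (j + 1) : ℕ) : ℤ) → dirIter L (j + 1) W Y = 0 →
      |dAction W Y (perWin d (N * L ^ (j + 1)))| ≤ κ * dirL1 Y (periodBox (d := d) (N * L ^ (j + 1))))
    (hTT : ∀ Z : Site d → Fin d → Matrix n n ℂ, IsSkewDir Z → IsPeriodicDir Z ((N * L ^ (j + 1) : ℕ) : ℤ) →
      IsLandauB8 (d := d) L N (j + 1) W Z → (∀ y μ, ‖Z y μ‖ ≤ α₀) →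
      ∀ Y : Site d → Fin d → Matrix n n ℂ, IsSkewDir Y → IsPeriodicDir Y ((N * L ^ (j + 1) : ℕ) : ℤ) → dirIter L (j + 1) W Y = 0 →
      ∃ Y' : Site d → Fin d → Matrix n n ℂ, IsSkewDir Y' ∧ IsPeriodicDir Y' ((N * L ^ (j + 1) : ℕ) : ℤ) ∧ dirIter L (j + 1) (vary W Z 1) Y' = 0 ∧
        |dAction (vary W Z 1) (fun y μ => Y' y μ - Y y μ) (perWin d (N * L ^ (j + 1)))| ≤ τ * dirL1 Y (periodBox (d := d) (N * L ^ (j + 1)))) :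
    SmallField U (x + (KG * (τ + ρ + κ) + cN + 28 * α₀ ^ 2)) := by
  have hL1 : 1 ≤ L := by omega
  -- brick E′: the Landau representative relative to `W`
  obtain ⟨u, Z, huU, huP, hZs, hZP, hrep, hLan, -, hZsup, -, -⟩ :=
    exists_landauRep_W hd hL j hWu hWP hx hs hWx hx10 hgrad hbx hcx hbx' hcx' hUu hUP hr₀ hb₀ hreg₁ hreg₂ hreg₃ hline
  have hZα : ∀ y μ, ‖Z y μ‖ ≤ α₀ := fun y μ => (hZsup y μ).trans hα₀
  -- tangent-criticality is gauge covariant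
  have hcrit' : ∀ Y' : Site d → Fin d → Matrix n n ℂ, IsSkewDir Y' → IsPeriodicDir Y' ((N * L ^ (j + 1) : ℕ) : ℤ) →
      dirIter L (j + 1) (vary W Z 1) Y' = 0 → dAction (vary W Z 1) Y' (perWin d (N * L ^ (j + 1))) = 0 := by
    rw [← hrep]
    exact tanCritical_gaugeAct hL1 j hUu hxU hsU hUxU huU huP hcritU
  -- the letters at this representative
  obtain ⟨AN, hNP, hNexact, hN7, hNorth, hTS⟩ := hNlift Z hZs hZP hLan hZα
  -- F55 on the representative
  have hSF : SmallField (vary W Z 1) (x + (KG * (τ + ρ + κ) + cN + 28 * α₀ ^ 2)) :=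
    smallField_vary_of_curvedLetters hL1 j hWu hx hs hWx hZs hZP hZα hNP hNexact hN7 hNorth S hTS hG hρ (hEXP Z hZs hZP hZα) hκ hWten
      hcrit' hτ (hTT Z hZs hZP hLan hZα)
  -- the radius is gauge invariant
  exact smallField_of_gaugeAct_eq huU hrep hSF

end

end Summit.QuantumFields.BalabanUV.T4Continuum.NE7ApeCurvedRepDocking
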